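import Summits.CriticalPhenomena.PercolationContinuityZ3.Theorems.PercNearOneGluingNoHeavyPcintLoopExclusionRungFourCounts
import Summits.CriticalPhenomena.PercolationContinuityZ3.Theorems.PercNearOneGluingNoHeavyPcintClosingHexagonsExact
import Summits.CriticalPhenomena.PercolationContinuityZ3.Theorems.PercNearOneGluingNoHeavyPcintClosingOctagonsExactAll
import Summits.CriticalPhenomena.PercolationContinuityZ3.Theorems.PercNearOneGluingNoHeavyPcintClosingDecagonsExactAll
import Summits.CriticalPhenomena.PercolationContinuityZ3.Theorems.PercNearOneGluingNoHeavyPcintPolyCert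
import HarnessLib

/-!
# CriticalPhenomena/PercolationContinuityZ3 — Theorems/PercNearOneGluingNoHeavyPcintChordDiagramLaw.lean: the CONNECTED-CHORD-DIAGRAM LAW (STRUCTURE P21) — typed, with the polygon instances `m = 2, 3, 4, 5` PROVED

Lane prim-pcint, STRUCTURE rule «numerics ⇒ structure ⇒ conjecture» (prim-pcint-2 GEN 19; pre-registered as P21, 2026-08-26 09:19Z, sha256
8e30ba33…, ALL items HIT at zero tolerance the same day — kit j253607 and CLS07 Table A8; prediction file run/shared/lean/prim/pcint/predictions/
P21-chord-diagram-law-memory12-2026-08-26.md).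

THE LAW.  Let `a(n)` be the number of CONNECTED CHORD DIAGRAMS with `n` chords (Touchard 1952, Riordan 1975; `a(1) = 1`,
`a(n) = (n−1)·Σ_{k=1}^{n−1} a(k)a(n−k)`: `1, 1, 4, 27, 248, 2830, 38232, 593859, …`; OEIS A000699), here `connChord`.
* **L1 (polygons)**: for every `m ≥ 2`, the rooted oriented `2m`-gon count of `ℤ^d` (the tree's `closingCount d (2m) = 2·2m·p_{2m}(ℤ^d)`, a
  polynomial in `d` of degree `m`) has leading coefficient `a(m)·2^m`: `closingCount d (2m)/(2d)^m → a(m)` (`polygonLeadingCoeffLaw`).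
  MECHANISM: to leading order in `1/d` a `2m`-gon uses `m` distinct axes, each once in each direction; its step word is a chord diagram on `2m`
  linearly ordered steps (a chord = the two uses of one axis); the word is self-avoiding iff no proper contiguous block is a union of chords, i.e.
  iff the diagram is connected; axes and orientations contribute `(σ/2)^m·2^m = σ^m`, `σ = 2d`.
* **L2 (memory deviations)**: for every `m ≥ 2`, `(2d)^m·(μ_{2m}(ℤ^d) − μ(ℤ^d)) → a(m+1)` (`memoryDeviationLaw`): the `1/(2d)`-expansion of the
  memory-`2m` growth constant agrees with Hara–Slade's expansion of the connective constant through order `(2d)^{1−m}` and first deviates at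
  order `(2d)^{−m}` by exactly the NEXT chord number (the walks counted by `μ_{2m}` but not by `μ` are, to leading order, the `(2m+2)`-gons).
EVIDENCE (all exact; integer series of the uniform class automata, gen 18/19): `m = 2`: `1 − (−3) = 4`; `m = 3`: `11 − (−16) = 27`;
`m = 4`: `146 − (−102) = 248`; `m = 5`: `2101 − (−729) = 2830`; `m = 6` (PRE-REGISTERED P21b, HIT): `32699 − (−5533) = 38232`; polygon leading
coefficients `1, 4, 27, 248` (theorems below), `2830` (P21c, HIT: `closingCount d 12 = 181120d⁶ − …`, all six coefficients as predicted, and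
`p_12(ℤ⁶) = 39 976 300` = Clisby–Liang–Slade 2007 Table A8).  Consequence (L3 of P21, the recipe `c_m = (a(m+1) + (2m−1)a(m) − δ_{m−1} +
A'_m)/a(m)` for the mean-field constants `2d(1 − R_{2m}) → c_m`): `c_2..c_6 = 2, 5/2, 70/27, 159/62, 3542/1415` — not monotone, whence the
refutation of C4 (c) in …LoopExclusionRungTenDimension.

PROVED HERE: `connChord` values `a(1..8)`; **L1 at `m = 2, 3, 4, 5`** (`polygonLeadingCoeff_two/three/four/five`) from the exact polygon
polynomials (…RungFourCounts, …ClosingHexagonsExact, …ClosingOctagonsExactAll, …ClosingDecagonsExactAll).  NOT proved: L1 for `m ≥ 6`, L2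
(the tree has no `1/d` expansion of `μ(ℤ^d)`).

HONEST FRAMING: a typed structure law with its first instances; nothing here is used by a certified `p_c` cell.  No `sorry`; standard axioms.
Sources: J. Touchard, Canad. J. Math. 4 (1952) 2–25; J. Riordan, Math. Comp. 29 (1975) 215–222 (connected chord diagrams) [folklore recurrence];
N. Clisby, R. Liang, G. Slade, J. Phys. A 40 (2007) 10973 [ClisbyLiangSlade2007] (eq. (1): the `1/d` expansion of `μ`; Tables A5–A8).
Written by prim-pcint-2 gen 19 (prover-prim-pcint-2-g19-0), 2026-08-26.
-/

noncomputable section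

open Filter Topology
open Literature.Probability.LatticeModels Literature.Probability.Percolation
open Literature.Probability.RandomPlanarGeometry.SAW.Zd (connectiveConstant)
open Summit.CriticalPhenomena.PercolationContinuityZ3.Theorems.Pcint
open Summit.CriticalPhenomena.PercolationContinuityZ3.Theorems.Pcint.PolyCert

namespace Summit.CriticalPhenomena.PercolationContinuityZ3.Theorems.Pcint.MemoryTail

variable {d : ℕ}

/-! ### Connected chord diagrams (Touchard–Riordan numbers) -/

/-- The list `[a(1), …, a(n)]` of connected-chord-diagram numbers, `a(N) = (N−1)·Σ_{k=1}^{N−1} a(k)a(N−k)`, `a(1) = 1`. [folklore] -/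
def connChordAux : ℕ → List ℕ
  | 0 => []
  | n + 1 =>
    let l := connChordAux n
    l ++ [if n = 0 then 1 else n * ((List.range n).map fun k => l.getD k 0 * l.getD (n - 1 - k) 0).sum]

/-- **`a(n)`** = the number of connected chord diagrams with `n` chords (`a(0) := 0`): `1, 1, 4, 27, 248, 2830, 38232, 593859, …`
(OEIS A000699). [folklore] -/
def connChord (n : ℕ) : ℕ := (connChordAux n).getD (n - 1) 0

/-- The first eight values: `a(1..8) = 1, 1, 4, 27, 248, 2830, 38232, 593859`. [folklore] -/
theorem connChord_values :
    connChord 1 = 1 ∧ connChord 2 = 1 ∧ connChord 3 = 4 ∧ connChord 4 = 27 ∧ connChord 5 = 248 ∧ connChord 6 = 2830 ∧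
      connChord 7 = 38232 ∧ connChord 8 = 593859 := by
  decide

/-! ### The typed law -/

/-- **L1 (STRUCTURE P21): the leading coefficient of the rooted oriented `2m`-gon count of `ℤ^d` is the connected-chord-diagram number**:
`closingCount d (2m) / (2d)^m → a(m)` as `d → ∞`, for every `m ≥ 2`.  Proved below for `m ≤ 5`; pre-registered and HIT at `m = 6`
(`181120 = 64·2830`).  STRUCTURE CONJ (prim-pcint-2 gen 19, 2026-08-26; not kernel-checked beyond `m = 5`). -/
@[conjecture] def polygonLeadingCoeffLaw : Prop :=
  ∀ m : ℕ, 2 ≤ m → Tendsto (fun d : ℕ => (closingCount d (2 * m) : ℝ) / (2 * (d : ℝ)) ^ m) atTop (𝓝 ((connChord m : ℕ) : ℝ))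

/-- **L2 (STRUCTURE P21): the first deviation of the memory-`2m` growth constant from the connective constant is the NEXT chord number**:
`(2d)^m·(μ_{2m}(ℤ^d) − μ(ℤ^d)) → a(m+1)` for every `m ≥ 2` (exact integer-series evidence `m = 2..6`: `4, 27, 248, 2830, 38232`, the last
pre-registered).  STRUCTURE CONJ (prim-pcint-2 gen 19; not kernel-checked: the tree has no `1/d` expansion of `μ`). -/
@[conjecture] def memoryDeviationLaw : Prop :=
  ∀ m : ℕ, 2 ≤ m →
    Tendsto (fun d : ℕ => (2 * (d : ℝ)) ^ m * (memGrowth d (2 * m) - connectiveConstant d)) atTop (𝓝 ((connChord (m + 1) : ℕ) : ℝ))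

/-! ### L1 at the first four rungs (theorems) -/

/-- Squeeze helper: if `a − C/d ≤ f d ≤ a + C/d` eventually then `f → a`. [folklore] -/
theorem tendsto_of_abs_le_div {f : ℕ → ℝ} {a C : ℝ} (d₀ : ℕ)
    (h : ∀ d : ℕ, d₀ ≤ d → a - C / d ≤ f d ∧ f d ≤ a + C / d) : Tendsto f atTop (𝓝 a) := by
  have h0 : Tendsto (fun d : ℕ => C / (d : ℝ)) atTop (𝓝 0) := tendsto_const_div_atTop_nhds_zero_nat C
  have hlo : Tendsto (fun d : ℕ => a - C / (d : ℝ)) atTop (𝓝 a) := by simpa using tendsto_const_nhds.sub h0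
  have hhi : Tendsto (fun d : ℕ => a + C / (d : ℝ)) atTop (𝓝 a) := by simpa using tendsto_const_nhds.add h0
  exact tendsto_of_tendsto_of_tendsto_of_le_of_le' hlo hhi (Filter.eventually_atTop.2 ⟨d₀, fun d hd => (h d hd).1⟩)
    (Filter.eventually_atTop.2 ⟨d₀, fun d hd => (h d hd).2⟩)

/-- **L1 at `m = 2`**: `closingCount d 4/(2d)² = 2d(2d−2)/(2d)² → 1 = a(2)`. [folklore] -/
theorem polygonLeadingCoeff_two : Tendsto (fun d : ℕ => (closingCount d (2 * 2) : ℝ) / (2 * (d : ℝ)) ^ 2) atTop (𝓝 ((connChord 2 : ℕ) : ℝ)) := by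
  rw [connChord_values.2.1, Nat.cast_one]
  refine tendsto_of_abs_le_div (C := 1) 1 fun d hd => ?_
  have hd' : (1 : ℝ) ≤ d := by exact_mod_cast hd
  have hd0 : (0 : ℝ) < d := by linarith
  have hc : (closingCount d (2 * 2) : ℝ) = 2 * d * (2 * d - 2) := by
    rw [closingCount_four_eq]; push_cast [Nat.cast_sub (show 2 ≤ 2 * d by omega)]; ring
  rw [hc]
  constructor
  · rw [le_div_iff₀ (by positivity)]
    have : ((1 : ℝ) - 1 / d) * (2 * (d : ℝ)) ^ 2 = 4 * d ^ 2 - 4 * d := by field_simp; ring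
    rw [this]; nlinarith
  · rw [div_le_iff₀ (by positivity)]
    have : ((1 : ℝ) + 1 / d) * (2 * (d : ℝ)) ^ 2 = 4 * d ^ 2 + 4 * d := by field_simp; ring
    rw [this]; nlinarith

/-- **L1 at `m = 3`**: `closingCount d 6/(2d)³ = 4d(d−1)(8d−13)/(2d)³ → 4 = a(3)`. [folklore] -/
theorem polygonLeadingCoeff_three : Tendsto (fun d : ℕ => (closingCount d (2 * 3) : ℝ) / (2 * (d : ℝ)) ^ 3) atTop (𝓝 ((connChord 3 : ℕ) : ℝ)) := by
  rw [connChord_values.2.2.1]; push_cast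
  refine tendsto_of_abs_le_div (C := 11) 4 fun d hd => ?_
  have hd' : (4 : ℝ) ≤ d := by exact_mod_cast hd
  have hd0 : (0 : ℝ) < d := by linarith
  rw [closingCount_six_eq_real hd]
  constructor
  · rw [le_div_iff₀ (by positivity)]
    have : ((4 : ℝ) - 11 / d) * (2 * (d : ℝ)) ^ 3 = 32 * d ^ 3 - 88 * d ^ 2 := by field_simp; ring
    rw [this]; nlinarith
  · rw [div_le_iff₀ (by positivity)]
    have : ((4 : ℝ) + 11 / d) * (2 * (d : ℝ)) ^ 3 = 32 * d ^ 3 + 88 * d ^ 2 := by field_simp; ring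
    rw [this]; nlinarith

/-- **L1 at `m = 4`**: `closingCount d 8/(2d)⁴ = (432d⁴ − 2096d³ + 3320d² − 1656d)/(2d)⁴ → 27 = a(4)`. [folklore] -/
theorem polygonLeadingCoeff_four : Tendsto (fun d : ℕ => (closingCount d (2 * 4) : ℝ) / (2 * (d : ℝ)) ^ 4) atTop (𝓝 ((connChord 4 : ℕ) : ℝ)) := by
  rw [connChord_values.2.2.2.1]; push_cast
  refine tendsto_of_abs_le_div (C := 140) 5 fun d hd => ?_
  have hd' : (5 : ℝ) ≤ d := by exact_mod_cast hd
  have hd0 : (0 : ℝ) < d := by linarith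
  rw [closingCount_eight_eq_real hd]
  have hd2 : (0 : ℝ) < (d : ℝ) ^ 2 := by positivity
  constructor
  · rw [le_div_iff₀ (by positivity)]
    have : ((27 : ℝ) - 140 / d) * (2 * (d : ℝ)) ^ 4 = 432 * d ^ 4 - 2240 * d ^ 3 := by field_simp; ring
    rw [this]; nlinarith [mul_pos hd0 hd2]
  · rw [div_le_iff₀ (by positivity)]
    have : ((27 : ℝ) + 140 / d) * (2 * (d : ℝ)) ^ 4 = 432 * d ^ 4 + 2240 * d ^ 3 := by field_simp; ring
    rw [this]; nlinarith [mul_pos hd0 hd2]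

/-- **L1 at `m = 5`**: `closingCount d 10/(2d)⁵ = (7936d⁵ − 60080d⁴ + …)/(2d)⁵ → 248 = a(5)`. [folklore] -/
theorem polygonLeadingCoeff_five : Tendsto (fun d : ℕ => (closingCount d (2 * 5) : ℝ) / (2 * (d : ℝ)) ^ 5) atTop (𝓝 ((connChord 5 : ℕ) : ℝ)) := by
  rw [connChord_values.2.2.2.2.1]; push_cast
  refine tendsto_of_abs_le_div (C := 2000) 6 fun d hd => ?_
  have hd' : (6 : ℝ) ≤ d := by exact_mod_cast hd
  have hd0 : (0 : ℝ) < d := by linarith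
  rw [closingCount_ten_eq_real hd]
  -- polynomial certificates (non-negative Taylor coefficients at 6) for the two sides
  have hlo : 0 ≤ peval [0, 90024, -207720, 169840, 3920] (d : ℝ) :=
    peval_nonneg_of_shift (c := 6) (by decide) (by exact_mod_cast hd')
  have hhi : 0 ≤ peval [0, -90024, 207720, -169840, 124080] (d : ℝ) :=
    peval_nonneg_of_shift (c := 6) (by decide) (by exact_mod_cast hd')
  simp only [peval] at hlo hhi
  push_cast at hlo hhi
  constructor
  · rw [le_div_iff₀ (by positivity)]
    have : ((248 : ℝ) - 2000 / d) * (2 * (d : ℝ)) ^ 5 = 7936 * d ^ 5 - 64000 * d ^ 4 := by field_simp; ring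
    rw [this]; nlinarith
  · rw [div_le_iff₀ (by positivity)]
    have : ((248 : ℝ) + 2000 / d) * (2 * (d : ℝ)) ^ 5 = 7936 * d ^ 5 + 64000 * d ^ 4 := by field_simp; ring
    rw [this]; nlinarith

/-- **L1 holds at every rung `2 ≤ m ≤ 5`.** [folklore] -/
theorem polygonLeadingCoeffLaw_of_le_five (m : ℕ) (hm : 2 ≤ m) (hm5 : m ≤ 5) :
    Tendsto (fun d : ℕ => (closingCount d (2 * m) : ℝ) / (2 * (d : ℝ)) ^ m) atTop (𝓝 ((connChord m : ℕ) : ℝ)) := by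
  interval_cases m
  · exact polygonLeadingCoeff_two
  · exact polygonLeadingCoeff_three
  · exact polygonLeadingCoeff_four
  · exact polygonLeadingCoeff_five

end Summit.CriticalPhenomena.PercolationContinuityZ3.Theorems.Pcint.MemoryTail
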